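import Literature.Computability.Cryptography.RegevSamplerScale
import Literature.Algebra.EuclideanLattices.RegevQuantumPartData
import Literature.Algebra.EuclideanLattices.RegevQuantumPartFibres
import HarnessLib

/-!
# Regev 2009, Lemma 3.14 in machine form: the classical data of the sampler in rescaled units

Topic `Computability/Cryptography` (family `pqc`), grouping namespace `Regev2009.SamplerGeom`; sequel of
`RegevSamplerScale.lean` (the rescaled instance lattice `L_t = t⁻¹ L(B)`) and of
`Algebra/EuclideanLattices/RegevQuantumPartData.lean` (Regev's concrete classical data on `ℝⁿ`: the box
`boxSet`, the reduction `yOfB = ZSpan.fract`, the coset index `sOfB`, and the box hypotheses). The law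
of the quantum part of Regev's sampler (J. ACM 56 (2009), art. 34, Lemma 3.14; `QPart.law_bound_of_basis`)
is stated over abstract data `(Box, y(·), s(·), Good)` subject to `QPart.FibreHyps` and three geometric
hypotheses. This file fixes the data of the reduction's sampler for a nonsingular instance `B`, a
modulus `R` and the rescaling `t` (Lemma 3.14 with promise radius `d`: `t = √n/d`):

* the fine lattice `LamT = L_t*/R` with bases `eT` (over `ℤ`) and `bRT = t • (b∨ⱼ/R)` (over `ℝ`), the
  grid modulus `DT = R|det B|/t` (every point of `LamT` has coordinates in `DT⁻¹ℤ`: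
  `exists_int_div_of_mem_lamT`, from `adjugate_col_eq`), the box `BoxT ℓ = boxSet n ℓ DT`, the
  reduction `yT = ZSpan.fract bRT`, the coset index `sT`, and the good points
  `GoodT x ⇔ ‖x − yT x‖ < √n` (short lattice part);
* **`fibreHyps_T`** — `FibreHyps LamT eT R (BoxT ℓ) yT sT GoodT`, given `λ₁(R·LamT) ≥ 2√n` (supplied by
  `SamplerScale.eq_zero_of_mem_scaledLattice_dualOver_scaledL` from Regev's `d < λ₁(L*)/2`);
* **`boxCoversShort_T`**, `norm_yT_le`, `norm_sub_yT_le`, `boxT_nonempty` — the geometric hypotheses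
  `hBox`, `hY`, `hB`, `hne` of the law, under `Σ‖bRTᵢ‖ ≤ Y` and `DT(√n + Y) + 1 ≤ 2^{ℓ-1}`;
* the dictionary with the sampler's integer arithmetic (`RegevSamplerArith.lean`): box points are
  `t • gridPt I R x̃` (`boxPt_eq_smul_gridPt`), `yT (t • g) = t • ZSpan.fract (eB I R) g` (`yT_smul`), and
  `GoodT (t • g) ⇔ ‖g − fract g‖ < √n/t` (`goodT_smul_iff`).

Everything is proved; definitions have bodies; no named fact is introduced.

## References

* O. Regev, *On lattices, learning with errors, random linear codes, and cryptography*, J. ACM 56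
  (2009), art. 34; author's version arXiv:2401.03703: Lemma 3.12 (proof), Lemma 3.14 (proof), p. 19–20
  [Regev2009].
* D. Micciancio, S. Goldwasser, *Complexity of Lattice Problems*, Kluwer 2002, Ch. 1 §1.1 (Cramer: the
  dual basis has entries in `(det B)⁻¹ℤ`) [MicciancioGoldwasser2002].
-/

noncomputable section

namespace Literature.Computability.Cryptography

namespace Regev2009

namespace SamplerGeom

open Literature.Algebra.EuclideanLattices Literature.Algebra.EuclideanLattices.Regev2009
  Literature.Algebra.EuclideanLattices.Regev2009.QPart Literature.Computability.QuantumComplexity.GaussianCells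
  Peikert2009 Matrix Finset SamplerArith SamplerScale Module
open scoped InnerProductSpace Pointwise

variable (I : LatticeInstance) [hZ : IsZLattice ℝ I.lattice] (R : ℕ) [NeZero R]

/-! ### Points of `L*/R` lie on the grid `(R|det B|)⁻¹ℤⁿ` -/

/-- The coordinates of `eⱼ = b∨ⱼ/R`: `(eⱼ)ᵢ = (adj B)ᵢⱼ/(R det B)`. [cite: MicciancioGoldwasser2002, Ch. 1 §1.1] -/
theorem eB_apply_apply (j i : Fin I.n) :
    eB I R j i = ((I.basis.adjugate i j : ℤ) : ℝ) / ((R : ℝ) * (I.basis.det : ℝ)) := by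
  have hdet : (I.basis.det : ℝ) ≠ 0 := by exact_mod_cast isNonsingular_of_isZLattice I
  have hR : (R : ℝ) ≠ 0 := by exact_mod_cast NeZero.ne R
  have h := congrArg (fun v : EuclideanSpace ℝ (Fin I.n) => v i) (adjugate_col_eq I j)
  simp only [PiLp.smul_apply, smul_eq_mul] at h
  rw [eB_apply, PiLp.smul_apply, smul_eq_mul]
  field_simp
  rw [h, mul_comm]

/-- **Every point of `Λ = L*/R` has coordinates in `(R|det B|)⁻¹ℤ`.** [cite: Regev2009, Lemma 3.14 (proof: the grid)] -/
theorem exists_int_div_of_mem_dualOver {u : EuclideanSpace ℝ (Fin I.n)} (hu : u ∈ dualOver R I.lattice (zBasis I))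
    (i : Fin I.n) : ∃ k : ℤ, u i = (k : ℝ) / (Dg I R : ℝ) := by
  have hdet : (I.basis.det : ℝ) ≠ 0 := by exact_mod_cast isNonsingular_of_isZLattice I
  have hR : (R : ℝ) ≠ 0 := by exact_mod_cast NeZero.ne R
  have hsgn : ((I.basis.det.sign : ℤ) : ℝ) ≠ 0 := by
    exact_mod_cast mt Int.sign_eq_zero_iff_zero.1 (isNonsingular_of_isZLattice I)
  obtain ⟨c, rfl⟩ := Submodule.mem_span_range_iff_exists_fun ℤ |>.1 hu
  refine ⟨I.basis.det.sign * ∑ j, c j * I.basis.adjugate i j, ?_⟩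
  have happ : (∑ j, c j • eB I R j : EuclideanSpace ℝ (Fin I.n)) i = ∑ j, (c j : ℝ) * eB I R j i := by
    rw [show (∑ j, c j • eB I R j : EuclideanSpace ℝ (Fin I.n)) = ∑ j, (c j : ℝ) • eB I R j from
      sum_congr rfl fun j _ => (Int.cast_smul_eq_zsmul ℝ (c j) (eB I R j)).symm]
    rw [WithLp.ofLp_sum, Finset.sum_apply]
    refine sum_congr rfl fun j _ => ?_
    rw [WithLp.ofLp_smul, Pi.smul_apply, smul_eq_mul]
  rw [happ]
  simp_rw [eB_apply_apply I R]
  have hDg : (Dg I R : ℝ) = R * (((I.basis.det.sign : ℤ) : ℝ) * (I.basis.det : ℝ)) := by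
    rw [Dg, Nat.cast_mul, sign_mul_det I]
  rw [hDg]
  simp only [Int.cast_mul, Int.cast_sum]
  have hne : (R : ℝ) * (((I.basis.det.sign : ℤ) : ℝ) * (I.basis.det : ℝ)) ≠ 0 := mul_ne_zero hR (mul_ne_zero hsgn hdet)
  rw [eq_div_iff hne, sum_mul, mul_sum]
  refine sum_congr rfl fun j _ => ?_
  field_simp

/-! ### The fine lattice `L_t*/R` and its grid -/

variable (t : ℝ) (ht : t ≠ 0)

/-- **The fine lattice `Λ_t = L_t*/R`** of the analysis in rescaled units. [cite: Regev2009, Lemma 3.14 ("L*/R")] -/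
abbrev LamT : Submodule ℤ (EuclideanSpace ℝ (Fin I.n)) := dualOver R (scaledL I t ht) (scaledZBasis I t ht)

/-- Its `ℤ`-basis. [folklore] -/
abbrev eT : Basis (Fin I.n) ℤ (LamT I R t ht) := dualOverZBasis R (scaledL I t ht) (scaledZBasis I t ht)

/-- Its real basis `t • (b∨ⱼ/R)`. [folklore] -/
abbrev bRT : Basis (Fin I.n) ℝ (EuclideanSpace ℝ (Fin I.n)) := dualOverBasis R (scaledL I t ht) (scaledZBasis I t ht)

omit hZ [NeZero R] in
/-- **The grid modulus in rescaled units** `D_t = R|det B|/t`. [cite: Regev2009, Lemma 3.14 (proof: the grid)] -/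
abbrev DT (t : ℝ) : ℝ := (Dg I R : ℝ) / t

/-- `v ∈ Λ_t ↔ t⁻¹ v ∈ Λ = L(B)*/R`. [folklore] -/
theorem mem_lamT_iff (v : EuclideanSpace ℝ (Fin I.n)) : v ∈ LamT I R t ht ↔ t⁻¹ • v ∈ dualOver R I.lattice (zBasis I) := by
  change v ∈ Submodule.span ℤ (Set.range (dualOverBasis R (scaledL I t ht) (scaledZBasis I t ht))) ↔
    t⁻¹ • v ∈ Submodule.span ℤ (Set.range (eB I R))
  rw [dualOverBasis_scaledL_eq, Basis.mem_span_iff_repr_mem, Basis.mem_span_iff_repr_mem]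
  simp only [Basis.repr_unitsSMul, Units.smul_def, smul_eq_mul, Units.val_inv_eq_inv_val, Units.val_mk0, map_smul,
    Finsupp.smul_apply]

/-- **Every point of `Λ_t` has coordinates in `D_t⁻¹ℤ`.** [cite: Regev2009, Lemma 3.14 (proof: the grid)] -/
theorem exists_int_div_of_mem_lamT {v : EuclideanSpace ℝ (Fin I.n)} (hv : v ∈ LamT I R t ht) (i : Fin I.n) :
    ∃ k : ℤ, v i = (k : ℝ) / DT I R t := by
  obtain ⟨k, hk⟩ := exists_int_div_of_mem_dualOver I R ((mem_lamT_iff I R t ht v).1 hv) i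
  refine ⟨k, ?_⟩
  rw [PiLp.smul_apply, smul_eq_mul] at hk
  have hv : v i = t * ((k : ℝ) / (Dg I R : ℝ)) := by
    rw [← hk, ← mul_assoc, mul_inv_cancel₀ ht, one_mul]
  rw [hv, DT]
  field_simp

/-! ### The classical data and the fibre hypotheses -/

/-- **The good points**: those with short lattice part, `‖x − y(x)‖ < √n` (on them the `CVP` answer
erases the register exactly). [cite: Regev2009, Lemma 3.14 (proof: "all points within distance d of L*")] -/
def GoodT (x : EuclideanSpace ℝ (Fin I.n)) : Prop :=
  ‖x - yOfB (bRT I R t ht) x‖ < Real.sqrt (finrank ℝ (EuclideanSpace ℝ (Fin I.n)))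

/-- `GoodT` is decidable (classically). [folklore] -/
instance instDecidablePredGoodT : DecidablePred (GoodT I R t ht) := Classical.decPred _

/-- **The fibre hypotheses hold for the sampler's data** `(boxSet, fract, coset index, short lattice
part)`, given `λ₁(R Λ_t) ≥ 2√n`. [cite: Regev2009, Lemma 3.12 (proof), Lemma 3.14 (proof)] -/
theorem fibreHyps_T (ℓ : ℕ)
    (hsv : ∀ z ∈ scaledLattice (LamT I R t ht) R, ‖z‖ < 2 * Real.sqrt (finrank ℝ (EuclideanSpace ℝ (Fin I.n))) → z = 0) :
    FibreHyps (LamT I R t ht) (eT I R t ht) R (boxSet I.n ℓ (DT I R t)) (yOfB (bRT I R t ht))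
      (sOfB (bRT I R t ht) (LamT I R t ht) (eT I R t ht) R) (GoodT I R t ht) where
  coset x _ := coset_yOfB_sOfB (eT I R t ht) R rfl x
  yuniq _ _ _ _ h := yOfB_eq_of_sub_mem (bRT I R t ht) h
  good_short _ _ h := h
  good_inj x _ x' _ hg hg' hy hs := by
    obtain ⟨z, hz⟩ := coset_yOfB_sOfB (bR := bRT I R t ht) (eT I R t ht) R rfl x
    obtain ⟨z', hz'⟩ := coset_yOfB_sOfB (bR := bRT I R t ht) (eT I R t ht) R rfl x'
    have hxx : x - x' = (x - yOfB (bRT I R t ht) x) - (x' - yOfB (bRT I R t ht) x') := by rw [hy]; abel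
    have hdiff : x - x' = (R : ℝ) • ((z - z' : LamT I R t ht) : EuclideanSpace ℝ (Fin I.n)) := by
      rw [hxx, hz, hz', hs, Submodule.coe_sub, smul_sub]; abel
    have hmem : x - x' ∈ scaledLattice (LamT I R t ht) R := by
      rw [hdiff]; exact smul_coe_mem_scaledLattice _ R (z - z')
    have hnorm : ‖x - x'‖ < 2 * Real.sqrt (finrank ℝ (EuclideanSpace ℝ (Fin I.n))) := by
      rw [hxx]
      refine (norm_sub_le _ _).trans_lt ?_
      have h1 : ‖x - yOfB (bRT I R t ht) x‖ < _ := hg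
      have h2 : ‖x' - yOfB (bRT I R t ht) x'‖ < _ := hg'
      linarith
    exact sub_eq_zero.1 (hsv _ hmem hnorm)

/-! ### The geometric hypotheses of the law -/

/-- `0 < D_t` (`0 < t`). [folklore] -/
theorem DT_pos {t : ℝ} (ht : 0 < t) : 0 < DT I R t := by
  have hD : 0 < Dg I R := Nat.pos_of_ne_zero (by
    have := detA_ne_zero (I := I); have := NeZero.ne R; unfold Dg; exact Nat.mul_ne_zero ‹_› ‹_›)
  exact div_pos (by exact_mod_cast hD) ht

/-- **The box covers the short shifts** for the sampler's data: under `Σ‖bRTᵢ‖ ≤ Y` and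
`D_t(√n + Y) + 1 ≤ 2^{ℓ−1}`. [cite: Regev2009, Lemma 3.12 (proof: "`ℤⁿ ∩ √n r Bₙ ⊆ {−√n r,…,√n r}ⁿ`")] -/
theorem boxCoversShort_T {t : ℝ} (ht : 0 < t) {ℓ : ℕ} (hℓ : 1 ≤ ℓ) {Y : ℝ} (hY : ∑ i, ‖bRT I R t ht.ne' i‖ ≤ Y)
    (hfit : DT I R t * (Real.sqrt I.n + Y) + 1 ≤ (2 : ℝ) ^ (ℓ - 1)) {x : EuclideanSpace ℝ (Fin I.n)}
    (hx : x ∈ boxSet I.n ℓ (DT I R t)) :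
    BoxCoversShort (LamT I R t ht.ne') (boxSet I.n ℓ (DT I R t)) (yOfB (bRT I R t ht.ne') x) :=
  boxCoversShort_boxSet (DT_pos I R ht) hℓ rfl (fun _ hv i => exists_int_div_of_mem_lamT I R t ht.ne' hv i) hY hfit hx

/-- **The size of the reductions**: `Σᵢ ‖bRTᵢ‖ = |t| R⁻¹ Σᵢ ‖b∨ᵢ‖`. [folklore] -/
theorem sum_norm_bRT : ∑ i, ‖bRT I R t ht i‖ = |t| * (R : ℝ)⁻¹ * ∑ i, ‖dualVec I i‖ := by
  rw [mul_sum]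
  refine sum_congr rfl fun i _ => ?_
  rw [dualOverBasis_scaledL, eB_apply, norm_smul, norm_smul, Real.norm_eq_abs, Real.norm_eq_abs,
    abs_inv, Nat.abs_cast, mul_assoc]

/-! ### Dictionary with the sampler's integer arithmetic -/

omit hZ [NeZero R] in
/-- **Box points are rescaled grid points**: the point of the block contents `Yb` for the modulus `D_t`
is `t • gridPt I R x̃` with `x̃ᵢ = cellPt ℓ (Yb i)`. [cite: Regev2009, Lemma 3.14 (proof: the grid)] -/
theorem boxPt_eq_smul_gridPt {ℓ : ℕ} (Yb : Fin I.n → Fin ℓ → Bool) :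
    boxPt (DT I R t) Yb = t • gridPt I R (fun i => cellPt ℓ (Yb i)) := by
  ext i
  rw [boxPt_apply, PiLp.smul_apply, smul_eq_mul, gridPt, PiLp.smul_apply, smul_eq_mul, intVecToEuclidean_apply, DT]
  by_cases hD : (Dg I R : ℝ) = 0
  · rw [hD]; simp
  · field_simp

/-- **The reduction scales**: `y_t(t g) = t • fract_e(g)`. [cite: Regev2009, Lemma 3.14 (proof: "x mod P(L*)")] -/
theorem yOfB_bRT_smul (g : EuclideanSpace ℝ (Fin I.n)) : yOfB (bRT I R t ht) (t • g) = t • ZSpan.fract (eB I R) g := by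
  rw [yOfB, show bRT I R t ht = (eB I R).unitsSMul fun _ => Units.mk0 t ht from dualOverBasis_scaledL_eq I t ht R,
    fract_smul_eq]

/-- The lattice part scales: `t g − y_t(t g) = t • (g − fract_e g)`. [folklore] -/
theorem smul_sub_yOfB_bRT (g : EuclideanSpace ℝ (Fin I.n)) :
    t • g - yOfB (bRT I R t ht) (t • g) = t • (g - ZSpan.fract (eB I R) g) := by
  rw [yOfB_bRT_smul, smul_sub]

/-- **Good ⇔ short lattice part in the original units**: `GoodT (t g) ⇔ ‖g − fract_e g‖ < √n/t` (`0 < t`;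
with `t = √n/d`: `⇔ ‖g − fract_e g‖ < d`). [cite: Regev2009, Lemma 3.14 (proof: "within distance d of L*")] -/
theorem goodT_smul_iff {t : ℝ} (ht : 0 < t) (g : EuclideanSpace ℝ (Fin I.n)) :
    GoodT I R t ht.ne' (t • g) ↔ ‖g - ZSpan.fract (eB I R) g‖ < Real.sqrt I.n / t := by
  unfold GoodT
  rw [smul_sub_yOfB_bRT, norm_smul, Real.norm_eq_abs, abs_of_pos ht, finrank_euclideanSpace_fin, lt_div_iff₀ ht, mul_comm]

end SamplerGeom

end Regev2009

end Literature.Computability.Cryptography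

end
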